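import Literature.IUT.HodgeArakelov.ThetaEnvDataRecordAutSaturatedOfCor110iiiNatural
import Literature.AnabelianGeometry.EtaleTheta.Discharge.Sec1AutPreservesDeltaTemp

/-!
# (R1b′)-hΔ and (HGAL) on the WHOLE `Π^tp_X` FROM THE NAMED FACT `AbsTopIII.Cor_1_10_iii_natural` (H := ⊤) — node
# IUTchII:Prop3.4(i) companion follow-up: the standing binder `hΔ` of the ROUTE-2 v2 / stable-of-Δ statements DISCHARGED

S. Mochizuki, *Inter-universal Teichmüller theory II*, kurims manuscript (Dec. 2020): Prop 3.4 (i) pp. 91–92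
[cite: Mochizuki2012, Prop 3.4 (i) p.91], Rmk. 1.4.1 (ii) p. 28 (the pointed inversion `ι`, an automorphism of
`Π^tp_{X̲̲}` over `G_K`), Ex. 1.8 (i) p. 35 l. 44–48 («`Δ ⊆ Π` for the [group-theoretic! — cf., e.g., [AbsAnab], Lemma 1.3.8]
subgroup»).  Claim key DISPUTED (D-0012).  [AbsTopIII] = S. Mochizuki, *Topics in absolute anabelian geometry III*, Cor. 1.10
(iii) p. 43 l. 27–30 with its functoriality clause p. 44 l. 33–34, tempered version Rmks. 1.9.1 / 1.9.2 / 1.10.2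
[cite: MochizukiAbsTopIII2015, Cor 1.10 (iii) p.43] — the NAMED FACT
`Literature.AnabelianGeometry.AbsoluteAnabelian.AbsTopIII.Cor_1_10_iii_natural` (statement-only, abc-iut-f-052, p465730; FACT-LIST
rows F-0396 / F-0348 retyped to printed strength, OPTION A; cell rulings C-R25 / C-R46 / C-R50 / C-R54).  [EtTh] = S. Mochizuki,
Publ. RIMS **45** (2009), proof of Thm. 1.6 p. 24 («the fact that `γ` maps `Δ^tp_{Xα}` onto `Δ^tp_{Xβ}`»).  abc-iut cell, layer
L6, seat abc-iut-w5-d169 (gen 8; holder lineage of node IUTchII:Prop3.4(i), CERT-L6 writer); companions of record abc-iut-C-hgal-2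
(p466250 / p467735, whose `deltaX_map_eq_of_cor_1_10_iii_natural` is the `X̲̲`-instance `H := Π^tp_{X̲̲}` of the same remark).

PROOF-ONLY (no definition, no `Prop`-valued fact, nothing restated).  The FACT quantifies over EVERY open subgroup of finite
index `H ≤ Π^tp_X`; at `H := ⊤ = Π^tp_X` (open, index `1`) it says that every topological automorphism `ι` of `Π^tp_X` lies over
`Inn(τ)|_{G_K}` for some `τ ∈ G_{ℚ_p}`, whence — pure algebra, abc-iut-w4-d014's `ThetaSetting.map_deltaTemp_eq_of_aug_conj`
(p-id of `Discharge/Sec1AutPreservesDeltaTemp`) — `ι(Δ^tp_X) = Δ^tp_X`: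
* `ThetaSetting.aug_conj_of_cor_1_10_iii_natural` — (HGAL) on `Π^tp_X` itself (transport `⊤ ≃ₜ* Π^tp_X` inside the proof);
* **`ThetaSetting.map_deltaTemp_eq_of_cor_1_10_iii_natural`** — the standing binder
  `hΔ : ∀ γ : Π^tp_X ≃ₜ* Π^tp_X, Δ^tp_X.map γ = Δ^tp_X` ((R1b′)-hΔ of GAP D-G-w4d010-2g and -2h; binder of abc-iut-w5-d072's
  `thetaCompanionOfAut`, of abc-iut-w5-d118's `rootHyp_of_cor28_i_innerAdjust`, of abc-iut-w6-d002's `…_of_deltaPreserving`, of the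
  ROUTE-2 v2 / stable-of-Δ statements of node IUTchII:Prop3.4(i)) — now a COROLLARY OF THE NAMED FACT + the origin datum `hj`
  (print's own route is [AbsAnab] Lem. 1.3.8 = F-0007, abc-iut-w4-d014's `map_deltaTemp_eq_of_preservesGeom`; this is a second,
  F-0396-based route — both are FACT-by-name, neither is asserted);
* **`EtaleLevels.prop34i_multiradiallyDefined_saturated_ofCor28i_innerAdjust_ofCor110iiiNatural_hΔfree`** (+ `exists_coeff_…`) and
  **`EtaleLevels.prop34i_multiradiallyDefined_saturated_ofCor28iStableOfDelta_ofCor110iiiNatural_hΔfree`** (+ `exists_coeff_…`) — the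
  ROUTE-2 v2 and stable-of-Δ statements of record of abc-iut-C-hgal-2's companion (p466250) with the binder `hΔ` DISCHARGED:
  residual BY NAME {F-0620 · F-0609 · F-0640 · F-0396/F-0348 = `hgal` · `hj` · `hq` (R3) · `hO'` · `hYcl` · `hT` · `hιe` · `hιX` ·
  `hstd` · `hDtau'` · record/tower data} — ONE BINDER FEWER than p466250's forms; in particular the stable-of-Δ form (whose `hInd` was
  already discharged from `hιX` + `hΔ` by abc-iut-w6-d002) now carries NEITHER `hInd` NOR `hΔ`.
HONEST FRAMING: a corollary of a named fact discharges nothing of print; `Cor_1_10_iii_natural` is OUR typed statement of a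
refereed result ([AbsTopIII], 2015), held statement-only and bound AT the instance `D` (relative to the interface `ThetaSetting`
its universal closure is a schema, as its docstring says); nothing here asserts anything of [IUTchII], [EtTh] or [AbsTopIII]; no
side taken on [IUTchIII] Cor. 3.12; typed ≠ proved.
-/

noncomputable section

open Topology

namespace Literature.AnabelianGeometry.EtaleTheta

namespace ThetaSetting

open Literature.AnabelianGeometry.SemiGraphs Literature.AnabelianGeometry.AbsoluteAnabelian
open Literature.NumberTheory.EllipticCurves

variable {p : ℕ} [Fact p.Prime] (D : ThetaSetting p)

/-- **(HGAL) on the whole `Π^tp_X` from the named fact** ([AbsTopIII] Cor. 1.10 (iii) with its printed functoriality,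
`AbsTopIII.Cor_1_10_iii_natural D`, at the open index-`1` subgroup `H := ⊤`, under print's hypothesis «strictly Belyi type»
rendered as the origin datum `hj`): every topological automorphism `ι` of `Π^tp_X` lies over `Inn(τ)|_{G_K}` for some
`τ ∈ G_{ℚ_p}`. [cite: MochizukiAbsTopIII2015, Cor 1.10 (iii) p.43] -/
theorem aug_conj_of_cor_1_10_iii_natural (hj : IsAlgebraic ℚ (tateJ D.qX)) (hgal : AbsTopIII.Cor_1_10_iii_natural D)
    (ι : D.PiTemp ≃ₜ* D.PiTemp) : ∃ τ : GQp p, ∀ x : D.PiTemp, D.aug (ι x) = τ * D.aug x * τ⁻¹ := by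
  -- the tautological topological isomorphism `⊤ ≃ₜ* Π^tp_X` and the automorphism of `⊤` induced by `ι`
  let e : (⊤ : Subgroup D.PiTemp) ≃ₜ* D.PiTemp :=
    { Subgroup.topEquiv with
      continuous_toFun := continuous_subtype_val
      continuous_invFun := continuous_id.subtype_mk fun g : D.PiTemp => Subgroup.mem_top g }
  let α : (⊤ : Subgroup D.PiTemp) ≃ₜ* (⊤ : Subgroup D.PiTemp) := e.trans (ι.trans e.symm)
  have hopen : IsOpen ((⊤ : Subgroup D.PiTemp) : Set D.PiTemp) := by
    rw [Subgroup.coe_top]; exact isOpen_univ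
  have hfi : (⊤ : Subgroup D.PiTemp).FiniteIndex := ⟨by rw [Subgroup.index_top]; exact one_ne_zero⟩
  obtain ⟨τ, hτ⟩ := hgal hj ⊤ hopen hfi α
  refine ⟨τ, fun x => ?_⟩
  have h := hτ ⟨x, Subgroup.mem_top x⟩
  -- `((α ⟨x, _⟩ : ⊤) : Π^tp_X) = ι x` by construction
  exact h

/-- **(R1b′)-hΔ FROM THE NAMED FACT**: under [AbsTopIII] Cor. 1.10 (iii) with its printed functoriality
(`AbsTopIII.Cor_1_10_iii_natural D`, F-0396/F-0348 retyped, p465730) and its printed hypothesis «strictly Belyi» (`hj`), every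
topological automorphism `ι` of `Π^tp_X` carries `Δ^tp_X = Ker(Π^tp_X ↠ G_K)` onto itself ([EtTh] proof of Thm. 1.6 p. 24
«`γ` maps `Δ^tp_{Xα}` onto `Δ^tp_{Xβ}`»; [IUTchII] Ex. 1.8 (i) «`Δ ⊆ Π` … group-theoretic»; print's route [AbsAnab] Lem. 1.3.8)
— here from (HGAL) at `H := ⊤` by pure algebra (abc-iut-w4-d014's `map_deltaTemp_eq_of_aug_conj`).  The STANDING binder `hΔ`
of the L6 consumers, in its exact shape. [cite: MochizukiEtTh2009, Thm 1.6 (i) p.24] -/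
theorem map_deltaTemp_eq_of_cor_1_10_iii_natural (hj : IsAlgebraic ℚ (tateJ D.qX))
    (hgal : AbsTopIII.Cor_1_10_iii_natural D) :
    ∀ γ : D.PiTemp ≃ₜ* D.PiTemp, D.DeltaTemp.map γ.toMulEquiv.toMonoidHom = D.DeltaTemp := by
  intro γ
  obtain ⟨τ, hτ⟩ := D.aug_conj_of_cor_1_10_iii_natural hj hgal γ
  exact D.map_deltaTemp_eq_of_aug_conj γ τ hτ

end ThetaSetting

end Literature.AnabelianGeometry.EtaleTheta

/-! ## Node IUTchII:Prop3.4(i): the ROUTE-2 v2 / stable-of-Δ statements of record with `hΔ` DISCHARGED -/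

namespace Literature.IUT.HodgeArakelov

open Literature.AnabelianGeometry.EtaleTheta Literature.AnabelianGeometry.SemiGraphs
open Literature.AnabelianGeometry.AbsoluteAnabelian Literature.NumberTheory.EllipticCurves
open CohomologySystemOfContH1 EtaleThetaDataOfSetting TemperedThetaMonoids ThetaCovers
open scoped Literature.AnabelianGeometry.EtaleTheta

namespace EtaleLevels

universe u

variable {p : ℕ} [Fact p.Prime] {D : Literature.AnabelianGeometry.EtaleTheta.ThetaSetting p}
  {E : D.EtaleThetaData} {l : ℕ} (C : E.DoubleUnderline l) (hC : D.Compat) (hS : D.Sec2Hyps)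
  (hl : l.Prime) (hp2 : p ≠ 2) (hpl : p ≠ l) (hζ : ∃ ζ : D.K, IsPrimitiveRoot ζ (4 * l))
  (mods : ∀ M : ℕ+, D.CyclotomeMod l M)
  (f : contCocycles D.toTheta D.DeltaTheta C.GtpYdduu) (hf : f ∈ C.rootCocycles hC)
  (hmods : ∀ (M M' : ℕ+) (h : (M : ℕ) ∣ (M' : ℕ)) (x : D.lDeltaTheta l),
    MuN.red p M M' h ((mods M').red x) = (mods M).red x)
  (h15 : Literature.AnabelianGeometry.EtaleTheta.ThetaSetting.Prop15iii E hC) (L : C.CuspLabels)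
  (hZ : ∀ M : ℕ+, Nonempty (ModelCyclotomes.lDeltaQuot (C.rigidData (mods M) hC hS h15 L) ≃*
    Literature.IUT.HodgeTheaters.ZHat))
  (hlim : Function.Bijective (rigidLimHom C hC hS hl hp2 hpl hζ mods f hf hmods h15 L hZ))
  [(EtaleThetaDataOfSetting.PiYdd C).Normal]
  (hq : IsQuotientMap D.toTheta) {N : ℕ+} (μ : D.CyclotomeMod l N)
  (R : RigidData.{0} N l) (hR : R = C.rigidData μ hC hS h15 L) (h218i : R.Cor218_i)
  -- ROUTE 2 inputs along the orbit embedding `ε` (abc-iut-w5-d118 / abc-iut-w6-d002 suppliers) — WITHOUT `hΔ`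
  {T : TemperedCoverData.{u} l} (ε : C.OrbitEmbedding T)
  (hιe : IsOpenEmbedding ε.ι) (h24 : T.Prop24) (hstd : (ThetaOrbitData.ofEmbedding ε hC hS).IsStandard)
  (h28 : (ThetaOrbitData.ofEmbedding ε hC hS).Cor28_i)
  (hDtau' : ∀ Γ : T.Gtp ≃ₜ* T.Gtp, (∀ S ∈ T.tower, S.map Γ.toMulEquiv.toMonoidHom = S) →
    ∃ u ∈ C.Huu, ∀ Dt ∈ (ThetaOrbitData.ofEmbedding ε hC hS).Dtau,
      Dt.map (Γ.trans (ThetaOrbitData.innerAutTop (ε.ι u))).toMulEquiv.toMonoidHom ∈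
        (ThetaOrbitData.ofEmbedding ε hC hS).Dtau)
  (hιX : ε.ι.range = T.tp T.PiX)
  -- index / constants / origin
  (ι₀ : (Pi C) ≃ₜ* (Pi C))
  {Es : Set ℕ+} (τw : D.CyclotomeTower l Es)
  (O : Submonoid (PadicAlgCl p)ˣ)
  (hO : ∀ (σ : GQp p) (u : (PadicAlgCl p)ˣ), u ∈ O → Units.map (σ : PadicAlgCl p →* PadicAlgCl p) u ∈ O)
  (hO' : D.IsEtThOrigin)
  (hYcl : (D.DtpY.map D.toHat.toMonoidHom).topologicalClosure ≤
    D.DtpY.map D.toHat.toMonoidHom ⊔ (⁅⁅D.DeltaHat, D.DeltaHat⁆, D.DeltaHat⁆).topologicalClosure)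
  (hT : D.IsTateOrigin)
  -- (P3) and now also `hΔ` := THE NAMED FACT + origin datum
  (hj : IsAlgebraic ℚ (Literature.NumberTheory.EllipticCurves.tateJ D.qX))
  (hgal : Literature.AnabelianGeometry.AbsoluteAnabelian.AbsTopIII.Cor_1_10_iii_natural D)

/-- **[IUTchII] Prop 3.4 (i) — MULTIRADIALITY OF SPLIT THETA MONOIDS AT THE GENUINE FUNCTOR, Route 2 v2 (inner-adjusted `Dtau`
clause), (P3) := the FACT and `hΔ` DISCHARGED from the same FACT**: abc-iut-C-hgal-2's
`prop34i_multiradiallyDefined_saturated_ofCor28i_innerAdjust_ofCor110iiiNatural` (p466250) at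
`hΔ := ThetaSetting.map_deltaTemp_eq_of_cor_1_10_iii_natural D hj hgal`.  Residual BY NAME: F-0620 · F-0609 `h24` · F-0640 `h28` ·
F-0396/F-0348 `hgal` · `hj` · `hq` · `hO'` · `hYcl` · `hT` · `hιe` · `hιX` · `hstd` · `hDtau'` · record/tower data — NO `hΔ`, no
anonymous anabelian hypothesis. [cite: Mochizuki2012, Prop 3.4 (i) p.92] -/
theorem prop34i_multiradiallyDefined_saturated_ofCor28i_innerAdjust_ofCor110iiiNatural_hΔfree
    (c : CyclotomeCoefficients (phi C) (D.lDeltaTheta l) (PadicAlgCl p)ˣ)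
    (hlev : ∀ (ζ : Literature.AnabelianGeometry.EtaleTheta.cyclotome (PadicAlgCl p)ˣ) (M : ℕ+),
      (((τw.modAll M).red (c.hom ζ) : MuN p M) : (PadicAlgCl p)ˣ) = (ζ : ℕ+ → (PadicAlgCl p)ˣ) M)
    {η : (C.thetaEnvData μ hC hS).PiYdd → MuN p N} (hη : η ∈ (C.thetaEnvData μ hC hS).thetaCocycles)
    (Γ : Type) [Group Γ] :
    haveI := hC.GtpYdd_normal
    ((ex18iii (ThetaSetting.ofDoubleUnderline C μ hC hS hl hp2 hpl hζ hη) Γ).toDagger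
      (TemperedThetaMonoids.prop34iRadialFunctor
        (thetaEnvTransportS C hC hS hl hp2 hpl hζ mods f hf hmods h15 L hZ
          (piYddCharacteristic_of_cor218_i C μ hC hS h15 L R hR h218i) hlim hq μ R hR h218i
          (h1LimKummerOn (phi C) (D.lDeltaTheta l) (PiYdd C) c (isOpen_stabilizer_units C)
            (finiteIndex_stabilizer_units C) O) ι₀
          (map_mrange_h1LimKummerOn_eq_of_galois C hq μ τw c hlev O hO hC hS h15 L R hR h218i hO'
            (hgal_of_hgalois C hO' hYcl hT hS hq μ hC h15 L R hR h218i τw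
      (hHGAL_of_cor_1_10_iii_natural C hj hgal)))
          (image_toLim_theta_thetaEnvData_of_rootHyp C hC hS hl hp2 hpl hζ mods f hf hmods h15 L hZ
            (piYddCharacteristic_of_cor218_i C μ hC hS h15 L R hR h218i) hlim hq μ R hR h218i
            (rootHyp_of_cor28_i_innerAdjust C ε hq μ hC hS h15 L R hR h218i hιe hιX
              (ThetaSetting.map_deltaTemp_eq_of_cor_1_10_iii_natural D hj hgal) h24 hstd h28 hDtau'))
          (image_thetaInfty_thetaEnvData_of_rootHyp C hC hS hl hp2 hpl hζ mods f hf hmods h15 L hZ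
            (piYddCharacteristic_of_cor218_i C μ hC hS h15 L R hR h218i) hlim hq μ R hR h218i
            (rootHyp_of_cor28_i_innerAdjust C ε hq μ hC hS h15 L R hR h218i hιe hιX
              (ThetaSetting.map_deltaTemp_eq_of_cor_1_10_iii_natural D hj hgal) h24 hstd h28 hDtau')) hη)
        Γ)).IsMultiradiallyDefined := by
  haveI := hC.GtpYdd_normal
  exact prop34i_multiradiallyDefined_saturated_ofCor28i_innerAdjust_ofCor110iiiNatural C hC hS hl hp2 hpl hζ mods f hf hmods
    h15 L hZ hlim hq μ R hR h218i ε hιe h24 hstd h28 hDtau' hιX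
    (ThetaSetting.map_deltaTemp_eq_of_cor_1_10_iii_natural D hj hgal) ι₀ τw O hO hO' hYcl hT hj hgal c hlev hη Γ

/-- **The same with the coefficient datum DISCHARGED** (`hΔc`): residual BY NAME {F-0620, F-0609, F-0640, F-0396/F-0348 `hgal`, `hj`,
`hq`, `hO'`, `hYcl`, `hT`, `hΔc`, `hιe`, `hιX`, `hstd`, `hDtau'`} + record/tower data — NO `hΔ`. [cite: Mochizuki2012, Prop 3.4 (i) p.92] -/
theorem exists_coeff_prop34i_multiradiallyDefined_saturated_ofCor28i_innerAdjust_ofCor110iiiNatural_hΔfree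
    (hΔc : IsCompact (D.DeltaTheta : Set D.GtpTheta))
    {η : (C.thetaEnvData μ hC hS).PiYdd → MuN p N} (hη : η ∈ (C.thetaEnvData μ hC hS).thetaCocycles)
    (Γ : Type) [Group Γ] :
    haveI := hC.GtpYdd_normal
    ∃ (c : CyclotomeCoefficients (phi C) (D.lDeltaTheta l) (PadicAlgCl p)ˣ)
      (hlev : ∀ (ζ : Literature.AnabelianGeometry.EtaleTheta.cyclotome (PadicAlgCl p)ˣ) (M : ℕ+),
        (((τw.modAll M).red (c.hom ζ) : MuN p M) : (PadicAlgCl p)ˣ) = (ζ : ℕ+ → (PadicAlgCl p)ˣ) M),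
      Function.Bijective c.hom ∧
      ((ex18iii (ThetaSetting.ofDoubleUnderline C μ hC hS hl hp2 hpl hζ hη) Γ).toDagger
        (TemperedThetaMonoids.prop34iRadialFunctor
          (thetaEnvTransportS C hC hS hl hp2 hpl hζ mods f hf hmods h15 L hZ
            (piYddCharacteristic_of_cor218_i C μ hC hS h15 L R hR h218i) hlim hq μ R hR h218i
            (h1LimKummerOn (phi C) (D.lDeltaTheta l) (PiYdd C) c (isOpen_stabilizer_units C)
              (finiteIndex_stabilizer_units C) O) ι₀
            (map_mrange_h1LimKummerOn_eq_of_galois C hq μ τw c hlev O hO hC hS h15 L R hR h218i hO'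
              (hgal_of_hgalois C hO' hYcl hT hS hq μ hC h15 L R hR h218i τw
      (hHGAL_of_cor_1_10_iii_natural C hj hgal)))
            (image_toLim_theta_thetaEnvData_of_rootHyp C hC hS hl hp2 hpl hζ mods f hf hmods h15 L hZ
              (piYddCharacteristic_of_cor218_i C μ hC hS h15 L R hR h218i) hlim hq μ R hR h218i
              (rootHyp_of_cor28_i_innerAdjust C ε hq μ hC hS h15 L R hR h218i hιe hιX
                (ThetaSetting.map_deltaTemp_eq_of_cor_1_10_iii_natural D hj hgal) h24 hstd h28 hDtau'))
            (image_thetaInfty_thetaEnvData_of_rootHyp C hC hS hl hp2 hpl hζ mods f hf hmods h15 L hZ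
              (piYddCharacteristic_of_cor218_i C μ hC hS h15 L R hR h218i) hlim hq μ R hR h218i
              (rootHyp_of_cor28_i_innerAdjust C ε hq μ hC hS h15 L R hR h218i hιe hιX
                (ThetaSetting.map_deltaTemp_eq_of_cor_1_10_iii_natural D hj hgal) h24 hstd h28 hDtau')) hη)
          Γ)).IsMultiradiallyDefined := by
  haveI := hC.GtpYdd_normal
  exact exists_coeff_prop34i_multiradiallyDefined_saturated_ofCor28i_innerAdjust_ofCor110iiiNatural C hC hS hl hp2 hpl hζ
    mods f hf hmods h15 L hZ hlim hq μ R hR h218i ε hιe h24 hstd h28 hDtau' hιX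
    (ThetaSetting.map_deltaTemp_eq_of_cor_1_10_iii_natural D hj hgal) ι₀ τw O hO hO' hYcl hT hj hgal hΔc hη Γ

/-- **[IUTchII] Prop 3.4 (i) — Route 2 stable-of-Δ, (P3) := the FACT, `hInd` from `hιX` + `hΔ` (abc-iut-w6-d002) and NOW
`hΔ` from the same FACT**: abc-iut-C-hgal-2's `prop34i_multiradiallyDefined_saturated_ofCor28iStableOfDelta_ofCor110iiiNatural`
(p466250) at `hΔ := ThetaSetting.map_deltaTemp_eq_of_cor_1_10_iii_natural D hj hgal`.  Residual BY NAME: F-0620 · F-0609 · F-0640 ·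
F-0396/F-0348 `hgal` · `hj` · `hq` · `hO'` · `hYcl` · `hT` · `hιe` · `hιX` · `hstd` · `hDtau'` · record/tower data — NEITHER `hInd`
NOR `hΔ`. [cite: Mochizuki2012, Prop 3.4 (i) p.92] -/
theorem prop34i_multiradiallyDefined_saturated_ofCor28iStableOfDelta_ofCor110iiiNatural_hΔfree
    (c : CyclotomeCoefficients (phi C) (D.lDeltaTheta l) (PadicAlgCl p)ˣ)
    (hlev : ∀ (ζ : Literature.AnabelianGeometry.EtaleTheta.cyclotome (PadicAlgCl p)ˣ) (M : ℕ+),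
      (((τw.modAll M).red (c.hom ζ) : MuN p M) : (PadicAlgCl p)ˣ) = (ζ : ℕ+ → (PadicAlgCl p)ˣ) M)
    {η : (C.thetaEnvData μ hC hS).PiYdd → MuN p N} (hη : η ∈ (C.thetaEnvData μ hC hS).thetaCocycles)
    (Γ : Type) [Group Γ] :
    haveI := hC.GtpYdd_normal
    ((ex18iii (ThetaSetting.ofDoubleUnderline C μ hC hS hl hp2 hpl hζ hη) Γ).toDagger
      (TemperedThetaMonoids.prop34iRadialFunctor
        (thetaEnvTransportS C hC hS hl hp2 hpl hζ mods f hf hmods h15 L hZ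
          (piYddCharacteristic_of_cor218_i C μ hC hS h15 L R hR h218i) hlim hq μ R hR h218i
          (h1LimKummerOn (phi C) (D.lDeltaTheta l) (PiYdd C) c (isOpen_stabilizer_units C)
            (finiteIndex_stabilizer_units C) O) ι₀
          (map_mrange_h1LimKummerOn_eq_of_galois C hq μ τw c hlev O hO hC hS h15 L R hR h218i hO'
            (hgal_of_hgalois C hO' hYcl hT hS hq μ hC h15 L R hR h218i τw
      (hHGAL_of_cor_1_10_iii_natural C hj hgal)))
          (image_toLim_theta_thetaEnvData_of_rootHyp C hC hS hl hp2 hpl hζ mods f hf hmods h15 L hZ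
            (piYddCharacteristic_of_cor218_i C μ hC hS h15 L R hR h218i) hlim hq μ R hR h218i
            (fun α => rootHyp_of_cor28_i_innerAdjust_of_deltaPreserving C hq α ε μ hC hS h15 L R hR h218i hιe hιX
              (ThetaSetting.map_deltaTemp_eq_of_cor_1_10_iii_natural D hj hgal) h24 hstd h28 hDtau'))
          (image_thetaInfty_thetaEnvData_of_rootHyp C hC hS hl hp2 hpl hζ mods f hf hmods h15 L hZ
            (piYddCharacteristic_of_cor218_i C μ hC hS h15 L R hR h218i) hlim hq μ R hR h218i
            (fun α => rootHyp_of_cor28_i_innerAdjust_of_deltaPreserving C hq α ε μ hC hS h15 L R hR h218i hιe hιX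
              (ThetaSetting.map_deltaTemp_eq_of_cor_1_10_iii_natural D hj hgal) h24 hstd h28 hDtau')) hη)
        Γ)).IsMultiradiallyDefined := by
  haveI := hC.GtpYdd_normal
  exact prop34i_multiradiallyDefined_saturated_ofCor28iStableOfDelta_ofCor110iiiNatural C hC hS hl hp2 hpl hζ mods f hf hmods
    h15 L hZ hlim hq μ R hR h218i ε hιe h24 hstd h28 hDtau' hιX
    (ThetaSetting.map_deltaTemp_eq_of_cor_1_10_iii_natural D hj hgal) ι₀ τw O hO hO' hYcl hT hj hgal c hlev hη Γ

/-- **The same with the coefficient datum DISCHARGED** (`hΔc`): residual BY NAME {F-0620, F-0609, F-0640, F-0396/F-0348 `hgal`, `hj`,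
`hq`, `hO'`, `hYcl`, `hT`, `hΔc`, `hιe`, `hιX`, `hstd`, `hDtau'`} + record/tower data — neither `hInd` nor `hΔ`.
[cite: Mochizuki2012, Prop 3.4 (i) p.92] -/
theorem exists_coeff_prop34i_multiradiallyDefined_saturated_ofCor28iStableOfDelta_ofCor110iiiNatural_hΔfree
    (hΔc : IsCompact (D.DeltaTheta : Set D.GtpTheta))
    {η : (C.thetaEnvData μ hC hS).PiYdd → MuN p N} (hη : η ∈ (C.thetaEnvData μ hC hS).thetaCocycles)
    (Γ : Type) [Group Γ] :
    haveI := hC.GtpYdd_normal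
    ∃ (c : CyclotomeCoefficients (phi C) (D.lDeltaTheta l) (PadicAlgCl p)ˣ)
      (hlev : ∀ (ζ : Literature.AnabelianGeometry.EtaleTheta.cyclotome (PadicAlgCl p)ˣ) (M : ℕ+),
        (((τw.modAll M).red (c.hom ζ) : MuN p M) : (PadicAlgCl p)ˣ) = (ζ : ℕ+ → (PadicAlgCl p)ˣ) M),
      Function.Bijective c.hom ∧
      ((ex18iii (ThetaSetting.ofDoubleUnderline C μ hC hS hl hp2 hpl hζ hη) Γ).toDagger
        (TemperedThetaMonoids.prop34iRadialFunctor
          (thetaEnvTransportS C hC hS hl hp2 hpl hζ mods f hf hmods h15 L hZ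
            (piYddCharacteristic_of_cor218_i C μ hC hS h15 L R hR h218i) hlim hq μ R hR h218i
            (h1LimKummerOn (phi C) (D.lDeltaTheta l) (PiYdd C) c (isOpen_stabilizer_units C)
              (finiteIndex_stabilizer_units C) O) ι₀
            (map_mrange_h1LimKummerOn_eq_of_galois C hq μ τw c hlev O hO hC hS h15 L R hR h218i hO'
              (hgal_of_hgalois C hO' hYcl hT hS hq μ hC h15 L R hR h218i τw
      (hHGAL_of_cor_1_10_iii_natural C hj hgal)))
            (image_toLim_theta_thetaEnvData_of_rootHyp C hC hS hl hp2 hpl hζ mods f hf hmods h15 L hZ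
              (piYddCharacteristic_of_cor218_i C μ hC hS h15 L R hR h218i) hlim hq μ R hR h218i
              (fun α => rootHyp_of_cor28_i_innerAdjust_of_deltaPreserving C hq α ε μ hC hS h15 L R hR h218i hιe hιX
                (ThetaSetting.map_deltaTemp_eq_of_cor_1_10_iii_natural D hj hgal) h24 hstd h28 hDtau'))
            (image_thetaInfty_thetaEnvData_of_rootHyp C hC hS hl hp2 hpl hζ mods f hf hmods h15 L hZ
              (piYddCharacteristic_of_cor218_i C μ hC hS h15 L R hR h218i) hlim hq μ R hR h218i
              (fun α => rootHyp_of_cor28_i_innerAdjust_of_deltaPreserving C hq α ε μ hC hS h15 L R hR h218i hιe hιX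
                (ThetaSetting.map_deltaTemp_eq_of_cor_1_10_iii_natural D hj hgal) h24 hstd h28 hDtau')) hη)
          Γ)).IsMultiradiallyDefined := by
  haveI := hC.GtpYdd_normal
  exact exists_coeff_prop34i_multiradiallyDefined_saturated_ofCor28iStableOfDelta_ofCor110iiiNatural C hC hS hl hp2 hpl hζ
    mods f hf hmods h15 L hZ hlim hq μ R hR h218i ε hιe h24 hstd h28 hDtau' hιX
    (ThetaSetting.map_deltaTemp_eq_of_cor_1_10_iii_natural D hj hgal) ι₀ τw O hO hO' hYcl hT hj hgal hΔc hη Γ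

end EtaleLevels

end Literature.IUT.HodgeArakelov

end
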